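import Mathlib.Tactic.LinearCombination
import Summits.SmoothPoincare4.SmoothPoincare4.Theorems.CongruenceShadowsNilpotentShadowsStandardJohnsonClassTwo
import HarnessLib

/-!
# Johnson generators III: transport of structure for realisers (helper for stub
`stub_johnsonGenerators`)

Line `saturated-torsor-descent`, crux `CongruenceShadows.NilpotentShadowsStandard`
(item stmt-SmoothPoincare4-14594).  For letters `u, v, w` of `S_g`, "`ψ` realises `(u, v, w)`" means:
`ψ` is IA and `ψ(x) x⁻¹ ≡ ⁅v, w⁆^⟨x,u⟩ ⁅w, u⁆^⟨x,v⟩ ⁅u, v⁆^⟨x,w⟩ (mod γ₃)` for every letter `x`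
(`⟨aⱼ, bⱼ⟩ = 1 = -⟨bⱼ, aⱼ⟩`), i.e. `τ₁(ψ) = u ∧ v ∧ w`; the phrase is spelled out in every statement.
* `realise_transport`: if `φ ∈ Aut S_g` sends every letter to a conjugate of a signed letter
  `(π x)^{e x}` with `(π, e)` (anti)symplectic, then `φ ψ φ⁻¹` (or its inverse) realises
  `(π u, π v, π w)` — the `Aut`-equivariance of `τ₁`;
* `realise_of_sign`, and the registered helper `helper_johnsonRealisePerm`: realisability is
  invariant under permutations of the triple (`ψ ↦ ψ⁻¹` for a transposition).
No definitions.
-/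

set_option linter.dupNamespace false

open Subgroup Literature.Topology.FourManifolds
open scoped commutatorElement

namespace Summit.SmoothPoincare4.SmoothPoincare4.Theorems.NilpotentShadowsStandard.SaturatedTorsorDescent

/-! ## Realising a basis `3`-vector: transport of structure

Throughout `S = SurfaceGroup g`, letters `x : Fin g × Bool` (`(j,false) = aⱼ`, `(j,true) = bⱼ`), the
pairing `⟨x, y⟩ = if … then 1 else if … then -1 else 0` (`⟨aⱼ, bⱼ⟩ = 1 = -⟨bⱼ, aⱼ⟩`), and for an
ordered triple `(u, v, w)` the contraction `T x = ⁅v, w⁆ ^ ⟨x, u⟩ ⁅w, u⁆ ^ ⟨x, v⟩ ⁅u, v⁆ ^ ⟨x, w⟩`;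
"`ψ` realises `(u, v, w)`" means: `ψ` is IA and `ψ(x) x⁻¹ ≡ T x (mod γ₃)` for every letter `x`
(i.e. `τ₁(ψ) = u ∧ v ∧ w`).  No definitions: the phrases are spelled out in every statement. -/

section Transport

variable {g : ℕ}


/-- Under an automorphism sending each letter to a conjugate of a signed letter, the class of a
letter commutator modulo `γ₃` is the signed permuted letter commutator. [folklore] -/
theorem quot_equiv_commutator (π : Fin g × Bool → Fin g × Bool) (e : Fin g × Bool → ℤ)
    (φ : SurfaceGroup g ≃* SurfaceGroup g)
    (hφ : ∀ x, ∃ h : SurfaceGroup g,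
      φ (PresentedGroup.of x : SurfaceGroup g) = h * (PresentedGroup.of (π x) : SurfaceGroup g) ^ (e x) * h⁻¹)
    (p q : Fin g × Bool) :
    ((φ ⁅(PresentedGroup.of p : SurfaceGroup g), (PresentedGroup.of q : SurfaceGroup g)⁆ : SurfaceGroup g) : SurfaceGroup g ⧸ (⊤ : Subgroup (SurfaceGroup g)).lowerCentralSeries 2) =
      ⁅(((PresentedGroup.of (π p) : SurfaceGroup g) : SurfaceGroup g) : SurfaceGroup g ⧸ (⊤ : Subgroup (SurfaceGroup g)).lowerCentralSeries 2), (((PresentedGroup.of (π q) : SurfaceGroup g) : SurfaceGroup g) : SurfaceGroup g ⧸ (⊤ : Subgroup (SurfaceGroup g)).lowerCentralSeries 2)⁆ ^ (e p * e q) := by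
  obtain ⟨h, hh⟩ := hφ p
  obtain ⟨k, hk⟩ := hφ q
  rw [map_commutatorElement, hh, hk, quot_commutatorElement, QuotientGroup.mk_mul, QuotientGroup.mk_mul,
    QuotientGroup.mk_inv, QuotientGroup.mk_zpow, QuotientGroup.mk_mul, QuotientGroup.mk_mul,
    QuotientGroup.mk_inv, QuotientGroup.mk_zpow, c2_conj_left quot_class_two,
    c2_conj_right quot_class_two, c2_zpow_left quot_class_two, c2_zpow_right quot_class_two,
    ← zpow_mul, mul_comm]


/-- The inverse of a signed-letter-permuting automorphism on a letter. [folklore] -/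
theorem equiv_symm_of (π : Fin g × Bool → Fin g × Bool) (e : Fin g × Bool → ℤ)
    (he : ∀ x, e x = 1 ∨ e x = -1) (φ : SurfaceGroup g ≃* SurfaceGroup g)
    (hφ : ∀ x, ∃ h : SurfaceGroup g,
      φ (PresentedGroup.of x : SurfaceGroup g) = h * (PresentedGroup.of (π x) : SurfaceGroup g) ^ (e x) * h⁻¹)
    (x' : Fin g × Bool) :
    ∃ k : SurfaceGroup g, φ.symm (PresentedGroup.of (π x') : SurfaceGroup g) = k * (PresentedGroup.of x' : SurfaceGroup g) ^ (e x') * k⁻¹ := by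
  obtain ⟨h, hh⟩ := hφ x'
  have hex : e x' * e x' = 1 := by rcases he x' with h1 | h1 <;> simp [h1]
  refine ⟨φ.symm h⁻¹, φ.injective ?_⟩
  simp only [map_mul, map_inv, map_zpow, MulEquiv.apply_symm_apply, inv_inv]
  rw [hh, conj_zpow, ← zpow_mul, hex, zpow_one]
  group

/-- **Equivariance on a letter.** For IA `ψ` and `φ` permuting signed letters up to conjugacy,
`(φ ψ φ⁻¹)(x) x⁻¹ ≡ φ ((ψ(x') x'⁻¹) ^ e(x'))` modulo `γ₃`, where `π x' = x`. [folklore] -/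
theorem quot_conj_tau_of (π : Fin g × Bool → Fin g × Bool) (e : Fin g × Bool → ℤ)
    (he : ∀ x, e x = 1 ∨ e x = -1) (φ ψ : SurfaceGroup g ≃* SurfaceGroup g)
    (hψ : (∀ s : SurfaceGroup g, ψ s * s⁻¹ ∈ (⊤ : Subgroup (SurfaceGroup g)).lowerCentralSeries 1))
    (hφ : ∀ x, ∃ h : SurfaceGroup g,
      φ (PresentedGroup.of x : SurfaceGroup g) = h * (PresentedGroup.of (π x) : SurfaceGroup g) ^ (e x) * h⁻¹)
    (x' : Fin g × Bool) :
    (((φ.symm.trans (ψ.trans φ)) (PresentedGroup.of (π x') : SurfaceGroup g) * (PresentedGroup.of (π x') : SurfaceGroup g)⁻¹ : SurfaceGroup g) : SurfaceGroup g ⧸ (⊤ : Subgroup (SurfaceGroup g)).lowerCentralSeries 2) =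
      ((φ ((ψ (PresentedGroup.of x' : SurfaceGroup g) * (PresentedGroup.of x' : SurfaceGroup g)⁻¹) ^ (e x')) : SurfaceGroup g) : SurfaceGroup g ⧸ (⊤ : Subgroup (SurfaceGroup g)).lowerCentralSeries 2) := by
  obtain ⟨k, hk⟩ := equiv_symm_of π e he φ hφ x'
  rw [conj_tau, hk]
  apply quot_congr_equiv φ
  rw [ia_quot_conj hψ, ia_quot_zpow hψ, QuotientGroup.mk_zpow]


/-- Exponent bookkeeping for signed permutations of `±1`-valued signs. [folklore] -/
private theorem sign_bookkeeping {σ ex ea eb ec p p' s : ℤ} (hex : ex * ex = 1)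
    (hp : p = σ * ex * ea * p') (hs : σ * ea * eb * ec = s) : eb * ec * p * ex = p' * s := by
  subst hp hs; linear_combination (σ * ea * eb * ec * p') * hex

/-- Products of signs `±1` are signs. [folklore] -/
private theorem sign_mul {a b : ℤ} (ha : a = 1 ∨ a = -1) (hb : b = 1 ∨ b = -1) :
    a * b = 1 ∨ a * b = -1 := by
  rcases ha with rfl | rfl <;> rcases hb with rfl | rfl <;> simp

/-- **A realiser up to sign is a realiser**: if `ψ` is IA with `ψ(x) x⁻¹ ≡ (T x) ^ s` for a sign
`s = ±1`, then `(u, v, w)` is realised (by `ψ` or `ψ⁻¹`). [folklore] -/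
theorem realise_of_sign (u v w : Fin g × Bool) (s : ℤ) (hs : s = 1 ∨ s = -1)
    (ψ : SurfaceGroup g ≃* SurfaceGroup g) (hψ : (∀ s : SurfaceGroup g, ψ s * s⁻¹ ∈ (⊤ : Subgroup (SurfaceGroup g)).lowerCentralSeries 1))
    (hτ : ∀ x : Fin g × Bool, ((ψ (PresentedGroup.of x : SurfaceGroup g) * (PresentedGroup.of x : SurfaceGroup g)⁻¹ : SurfaceGroup g) : SurfaceGroup g ⧸ (⊤ : Subgroup (SurfaceGroup g)).lowerCentralSeries 2) =
      ((⁅(PresentedGroup.of v : SurfaceGroup g), (PresentedGroup.of w : SurfaceGroup g)⁆ ^ (if x.1 = u.1 ∧ x.2 = false ∧ u.2 = true then (1 : ℤ) else if x.1 = u.1 ∧ x.2 = true ∧ u.2 = false then (-1 : ℤ) else 0) * ⁅(PresentedGroup.of w : SurfaceGroup g), (PresentedGroup.of u : SurfaceGroup g)⁆ ^ (if x.1 = v.1 ∧ x.2 = false ∧ v.2 = true then (1 : ℤ) else if x.1 = v.1 ∧ x.2 = true ∧ v.2 = false then (-1 : ℤ) else 0) * ⁅(PresentedGroup.of u : SurfaceGroup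 g), (PresentedGroup.of v : SurfaceGroup g)⁆ ^ (if x.1 = w.1 ∧ x.2 = false ∧ w.2 = true then (1 : ℤ) else if x.1 = w.1 ∧ x.2 = true ∧ w.2 = false then (-1 : ℤ) else 0) : SurfaceGroup g) : SurfaceGroup g ⧸ (⊤ : Subgroup (SurfaceGroup g)).lowerCentralSeries 2) ^ s) :
    ∃ ψ : SurfaceGroup g ≃* SurfaceGroup g, (∀ s : SurfaceGroup g, ψ s * s⁻¹ ∈ (⊤ : Subgroup (SurfaceGroup g)).lowerCentralSeries 1) ∧ ∀ x : Fin g × Bool, ψ (PresentedGroup.of x : SurfaceGroup g) * (PresentedGroup.of x : SurfaceGroup g)⁻¹ * (⁅(PresentedGroup.of v : SurfaceGroup g), (PresentedGroup.of w : SurfaceGroup g)⁆ ^ (if x.1 = u.1 ∧ x.2 = false ∧ u.2 = true then (1 : ℤ) else if x.1 = u.1 ∧ x.2 = true ∧ u.2 = false then (-1 : ℤ) else 0) * ⁅(PresentedGroup.of w : SurfaceGroup g), (PresentedGroup.of u : SurfaceGroup g)⁆ ^ (if x.1 = v.1 ∧ x.2 = false ∧ v.2 = true then (1 : ℤ) else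 if x.1 = v.1 ∧ x.2 = true ∧ v.2 = false then (-1 : ℤ) else 0) * ⁅(PresentedGroup.of u : SurfaceGroup g), (PresentedGroup.of v : SurfaceGroup g)⁆ ^ (if x.1 = w.1 ∧ x.2 = false ∧ w.2 = true then (1 : ℤ) else if x.1 = w.1 ∧ x.2 = true ∧ w.2 = false then (-1 : ℤ) else 0))⁻¹ ∈ (⊤ : Subgroup (SurfaceGroup g)).lowerCentralSeries 2 := by
  rcases hs with rfl | rfl
  · refine ⟨ψ, hψ, fun x => ?_⟩
    rw [mul_inv_mem_iff_quot, hτ x, zpow_one]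
  · refine ⟨ψ.symm, ia_symm hψ, fun x => ?_⟩
    rw [mul_inv_mem_iff_quot, ia_quot_symm hψ, hτ x, zpow_neg, zpow_one, inv_inv]

/-- **Transport of realisers by signed letter permutations.**  Let `φ` be an automorphism of `S`
sending every letter `x` to a conjugate of `(π x) ^ (e x)` (`e = ±1`), where `(π, e)` is
`σ`-symplectic for the pairing (`⟨x, y⟩ = σ e(x) e(y) ⟨πx, πy⟩`, `σ = ±1`, `π` onto).  If `(u, v, w)`
is realised then so is `(π u, π v, π w)` (by `(φ ψ φ⁻¹) ^ {±1}`): the `Aut`-equivariance of `τ₁`.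
[folklore] -/
theorem realise_transport (π π' : Fin g × Bool → Fin g × Bool) (e : Fin g × Bool → ℤ) (σ : ℤ)
    (hπ : ∀ x, π (π' x) = x) (he : ∀ x, e x = 1 ∨ e x = -1) (hσ : σ = 1 ∨ σ = -1)
    (hP : ∀ x y : Fin g × Bool, (if x.1 = y.1 ∧ x.2 = false ∧ y.2 = true then (1 : ℤ) else if x.1 = y.1 ∧ x.2 = true ∧ y.2 = false then (-1 : ℤ) else 0) =
      σ * e x * e y * (if (π x).1 = (π y).1 ∧ (π x).2 = false ∧ (π y).2 = true then (1 : ℤ) else if (π x).1 = (π y).1 ∧ (π x).2 = true ∧ (π y).2 = false then (-1 : ℤ) else 0))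
    (φ : SurfaceGroup g ≃* SurfaceGroup g)
    (hφ : ∀ x, ∃ h : SurfaceGroup g,
      φ (PresentedGroup.of x : SurfaceGroup g) = h * (PresentedGroup.of (π x) : SurfaceGroup g) ^ (e x) * h⁻¹)
    (u v w : Fin g × Bool) :
    (∃ ψ : SurfaceGroup g ≃* SurfaceGroup g, (∀ s : SurfaceGroup g, ψ s * s⁻¹ ∈ (⊤ : Subgroup (SurfaceGroup g)).lowerCentralSeries 1) ∧ ∀ x : Fin g × Bool, ψ (PresentedGroup.of x : SurfaceGroup g) * (PresentedGroup.of x : SurfaceGroup g)⁻¹ * (⁅(PresentedGroup.of v : SurfaceGroup g), (PresentedGroup.of w : SurfaceGroup g)⁆ ^ (if x.1 = u.1 ∧ x.2 = false ∧ u.2 = true then (1 : ℤ) else if x.1 = u.1 ∧ x.2 = true ∧ u.2 = false then (-1 : ℤ) else 0) * ⁅(PresentedGroup.of w : SurfaceGroup g), (PresentedGroup.of u : SurfaceGroup g)⁆ ^ (if x.1 = v.1 ∧ x.2 = false ∧ v.2 = true then (1 : ℤ) else if x.1 = v.1 ∧ x.2 = true ∧ v.2 = false then (-1 : ℤ) else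 0) * ⁅(PresentedGroup.of u : SurfaceGroup g), (PresentedGroup.of v : SurfaceGroup g)⁆ ^ (if x.1 = w.1 ∧ x.2 = false ∧ w.2 = true then (1 : ℤ) else if x.1 = w.1 ∧ x.2 = true ∧ w.2 = false then (-1 : ℤ) else 0))⁻¹ ∈ (⊤ : Subgroup (SurfaceGroup g)).lowerCentralSeries 2) →
    ∃ ψ : SurfaceGroup g ≃* SurfaceGroup g, (∀ s : SurfaceGroup g, ψ s * s⁻¹ ∈ (⊤ : Subgroup (SurfaceGroup g)).lowerCentralSeries 1) ∧ ∀ x : Fin g × Bool, ψ (PresentedGroup.of x : SurfaceGroup g) * (PresentedGroup.of x : SurfaceGroup g)⁻¹ * (⁅(PresentedGroup.of (π v) : SurfaceGroup g), (PresentedGroup.of (π w) : SurfaceGroup g)⁆ ^ (if x.1 = (π u).1 ∧ x.2 = false ∧ (π u).2 = true then (1 : ℤ) else if x.1 = (π u).1 ∧ x.2 = true ∧ (π u).2 = false then (-1 : ℤ) else 0) * ⁅(PresentedGroup.of (π w) : SurfaceGroup g), (PresentedGroup.of (π u) : SurfaceGroup g)⁆ ^ (if x.1 = (π v).1 ∧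 x.2 = false ∧ (π v).2 = true then (1 : ℤ) else if x.1 = (π v).1 ∧ x.2 = true ∧ (π v).2 = false then (-1 : ℤ) else 0) * ⁅(PresentedGroup.of (π u) : SurfaceGroup g), (PresentedGroup.of (π v) : SurfaceGroup g)⁆ ^ (if x.1 = (π w).1 ∧ x.2 = false ∧ (π w).2 = true then (1 : ℤ) else if x.1 = (π w).1 ∧ x.2 = true ∧ (π w).2 = false then (-1 : ℤ) else 0))⁻¹ ∈ (⊤ : Subgroup (SurfaceGroup g)).lowerCentralSeries 2 := by
  rintro ⟨ψ, hψ, hτ⟩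
  refine realise_of_sign (π u) (π v) (π w) (σ * e u * e v * e w)
    (sign_mul (sign_mul (sign_mul hσ (he u)) (he v)) (he w)) (φ.symm.trans (ψ.trans φ))
    (ia_conj hψ φ) fun x => ?_
  have hτ' : ∀ y : Fin g × Bool, ((ψ (PresentedGroup.of y : SurfaceGroup g) * (PresentedGroup.of y : SurfaceGroup g)⁻¹ : SurfaceGroup g) : SurfaceGroup g ⧸ (⊤ : Subgroup (SurfaceGroup g)).lowerCentralSeries 2) =
      ((⁅(PresentedGroup.of v : SurfaceGroup g), (PresentedGroup.of w : SurfaceGroup g)⁆ ^ (if y.1 = u.1 ∧ y.2 = false ∧ u.2 = true then (1 : ℤ) else if y.1 = u.1 ∧ y.2 = true ∧ u.2 = false then (-1 : ℤ) else 0) * ⁅(PresentedGroup.of w : SurfaceGroup g), (PresentedGroup.of u : SurfaceGroup g)⁆ ^ (if y.1 = v.1 ∧ y.2 = false ∧ v.2 = true then (1 : ℤ) else if y.1 = v.1 ∧ y.2 = true ∧ v.2 = false then (-1 : ℤ) else 0) * ⁅(PresentedGroup.of u : SurfaceGroup g), (PresentedGroup.of v : SurfaceGroup g)⁆ ^ (if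 y.1 = w.1 ∧ y.2 = false ∧ w.2 = true then (1 : ℤ) else if y.1 = w.1 ∧ y.2 = true ∧ w.2 = false then (-1 : ℤ) else 0) : SurfaceGroup g) : SurfaceGroup g ⧸ (⊤ : Subgroup (SurfaceGroup g)).lowerCentralSeries 2) := fun y => (mul_inv_mem_iff_quot _ _ _).1 (hτ y)
  have hex : e (π' x) * e (π' x) = 1 := by rcases he (π' x) with h1 | h1 <;> simp [h1]
  have key := quot_conj_tau_of π e he φ ψ hψ hφ (π' x)
  rw [hπ] at key
  -- push `φ` and the quotient map through the contraction
  have step : ((φ ((⁅(PresentedGroup.of v : SurfaceGroup g), (PresentedGroup.of w : SurfaceGroup g)⁆ ^ (if (π' x).1 = u.1 ∧ (π' x).2 = false ∧ u.2 = true then (1 : ℤ) else if (π' x).1 = u.1 ∧ (π' x).2 = true ∧ u.2 = false then (-1 : ℤ) else 0) * ⁅(PresentedGroup.of w : SurfaceGroup g), (PresentedGroup.of u : SurfaceGroup g)⁆ ^ (if (π' x).1 = v.1 ∧ (π' x).2 = false ∧ v.2 = true then (1 : ℤ) else if (π' x).1 = v.1 ∧ (π' x).2 = true ∧ v.2 =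 false then (-1 : ℤ) else 0) * ⁅(PresentedGroup.of u : SurfaceGroup g), (PresentedGroup.of v : SurfaceGroup g)⁆ ^ (if (π' x).1 = w.1 ∧ (π' x).2 = false ∧ w.2 = true then (1 : ℤ) else if (π' x).1 = w.1 ∧ (π' x).2 = true ∧ w.2 = false then (-1 : ℤ) else 0)) ^ e (π' x)) : SurfaceGroup g) : SurfaceGroup g ⧸ (⊤ : Subgroup (SurfaceGroup g)).lowerCentralSeries 2) =
      (⁅(((PresentedGroup.of (π v) : SurfaceGroup g) : SurfaceGroup g) : SurfaceGroup g ⧸ (⊤ : Subgroup (SurfaceGroup g)).lowerCentralSeries 2), (((PresentedGroup.of (π w) : SurfaceGroup g) : SurfaceGroup g) : SurfaceGroup g ⧸ (⊤ : Subgroup (SurfaceGroup g)).lowerCentralSeries 2)⁆ ^ (e v * e w * (if (π' x).1 = u.1 ∧ (π' x).2 = false ∧ u.2 = true then (1 : ℤ) else if (π' x).1 = u.1 ∧ (π' x).2 = true ∧ u.2 = false then (-1 : ℤ) else 0)) *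
        ⁅(((PresentedGroup.of (π w) : SurfaceGroup g) : SurfaceGroup g) : SurfaceGroup g ⧸ (⊤ : Subgroup (SurfaceGroup g)).lowerCentralSeries 2), (((PresentedGroup.of (π u) : SurfaceGroup g) : SurfaceGroup g) : SurfaceGroup g ⧸ (⊤ : Subgroup (SurfaceGroup g)).lowerCentralSeries 2)⁆ ^ (e w * e u * (if (π' x).1 = v.1 ∧ (π' x).2 = false ∧ v.2 = true then (1 : ℤ) else if (π' x).1 = v.1 ∧ (π' x).2 = true ∧ v.2 = false then (-1 : ℤ) else 0)) *
        ⁅(((PresentedGroup.of (π u) : SurfaceGroup g) : SurfaceGroup g) : SurfaceGroup g ⧸ (⊤ : Subgroup (SurfaceGroup g)).lowerCentralSeries 2), (((PresentedGroup.of (π v) : SurfaceGroup g) : SurfaceGroup g) : SurfaceGroup g ⧸ (⊤ : Subgroup (SurfaceGroup g)).lowerCentralSeries 2)⁆ ^ (e u * e v * (if (π' x).1 = w.1 ∧ (π' x).2 = false ∧ w.2 = true then (1 : ℤ) else if (π' x).1 = w.1 ∧ (π' x).2 = true ∧ w.2 = false then (-1 : ℤ) else 0))) ^ e (π' x) :=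 by
    rw [map_zpow, QuotientGroup.mk_zpow, map_mul, map_mul, map_zpow, map_zpow, map_zpow,
      QuotientGroup.mk_mul, QuotientGroup.mk_mul, QuotientGroup.mk_zpow, QuotientGroup.mk_zpow,
      QuotientGroup.mk_zpow, quot_equiv_commutator π e φ hφ, quot_equiv_commutator π e φ hφ,
      quot_equiv_commutator π e φ hφ, ← zpow_mul, ← zpow_mul, ← zpow_mul]
  have hx := quot_congr_equiv φ (show (((ψ (PresentedGroup.of (π' x) : SurfaceGroup g) * (PresentedGroup.of (π' x) : SurfaceGroup g)⁻¹) ^ e (π' x) : SurfaceGroup g) : SurfaceGroup g ⧸ (⊤ : Subgroup (SurfaceGroup g)).lowerCentralSeries 2) =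
      (((⁅(PresentedGroup.of v : SurfaceGroup g), (PresentedGroup.of w : SurfaceGroup g)⁆ ^ (if (π' x).1 = u.1 ∧ (π' x).2 = false ∧ u.2 = true then (1 : ℤ) else if (π' x).1 = u.1 ∧ (π' x).2 = true ∧ u.2 = false then (-1 : ℤ) else 0) * ⁅(PresentedGroup.of w : SurfaceGroup g), (PresentedGroup.of u : SurfaceGroup g)⁆ ^ (if (π' x).1 = v.1 ∧ (π' x).2 = false ∧ v.2 = true then (1 : ℤ) else if (π' x).1 = v.1 ∧ (π' x).2 = true ∧ v.2 = false then (-1 : ℤ) else 0) * ⁅(PresentedGroup.of u : SurfaceGroup g), (PresentedGroup.of v : SurfaceGroup g)⁆ ^ (if (π' x).1 = w.1 ∧ (π' x).2 = false ∧ w.2 = true then (1 : ℤ) else if (π' x).1 = w.1 ∧ (π' x).2 = true ∧ w.2 = false then (-1 : ℤ) else 0)) ^ e (π' x) : SurfaceGroup g) : SurfaceGroup g ⧸ (⊤ : Subgroup (SurfaceGroup g)).lowerCentralSeries 2) by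
    rw [QuotientGroup.mk_zpow, QuotientGroup.mk_zpow, hτ'])
  rw [key, hx, step, c2_triple_zpow quot_class_two, QuotientGroup.mk_mul, QuotientGroup.mk_mul,
    QuotientGroup.mk_zpow, QuotientGroup.mk_zpow, QuotientGroup.mk_zpow, quot_commutatorElement,
    quot_commutatorElement, quot_commutatorElement, c2_triple_zpow quot_class_two]
  have h1 := hP (π' x) u
  have h2 := hP (π' x) v
  have h3 := hP (π' x) w
  simp only [hπ] at h1 h2 h3
  rw [sign_bookkeeping hex h1 rfl,
    sign_bookkeeping hex h2 (show σ * e v * e w * e u = σ * e u * e v * e w by ring),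
    sign_bookkeeping hex h3 (show σ * e w * e u * e v = σ * e u * e v * e w by ring)]

/-- **Realisers are invariant under rotating the triple**: `(u, v, w) → (v, w, u)` (same `ψ`).
[folklore] -/
theorem realise_rotate (u v w : Fin g × Bool) :
    (∃ ψ : SurfaceGroup g ≃* SurfaceGroup g, (∀ s : SurfaceGroup g, ψ s * s⁻¹ ∈ (⊤ : Subgroup (SurfaceGroup g)).lowerCentralSeries 1) ∧ ∀ x : Fin g × Bool, ψ (PresentedGroup.of x : SurfaceGroup g) * (PresentedGroup.of x : SurfaceGroup g)⁻¹ * (⁅(PresentedGroup.of v : SurfaceGroup g), (PresentedGroup.of w : SurfaceGroup g)⁆ ^ (if x.1 = u.1 ∧ x.2 = false ∧ u.2 = true then (1 : ℤ) else if x.1 = u.1 ∧ x.2 = true ∧ u.2 = false then (-1 : ℤ) else 0) * ⁅(PresentedGroup.of w : SurfaceGroup g), (PresentedGroup.of u : SurfaceGroup g)⁆ ^ (if x.1 = v.1 ∧ x.2 = false ∧ v.2 = true then (1 : ℤ) else if x.1 = v.1 ∧ x.2 = true ∧ v.2 = false then (-1 : ℤ) else 0) * ⁅(PresentedGroup.of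 u : SurfaceGroup g), (PresentedGroup.of v : SurfaceGroup g)⁆ ^ (if x.1 = w.1 ∧ x.2 = false ∧ w.2 = true then (1 : ℤ) else if x.1 = w.1 ∧ x.2 = true ∧ w.2 = false then (-1 : ℤ) else 0))⁻¹ ∈ (⊤ : Subgroup (SurfaceGroup g)).lowerCentralSeries 2) →
    ∃ ψ : SurfaceGroup g ≃* SurfaceGroup g, (∀ s : SurfaceGroup g, ψ s * s⁻¹ ∈ (⊤ : Subgroup (SurfaceGroup g)).lowerCentralSeries 1) ∧ ∀ x : Fin g × Bool, ψ (PresentedGroup.of x : SurfaceGroup g) * (PresentedGroup.of x : SurfaceGroup g)⁻¹ * (⁅(PresentedGroup.of w : SurfaceGroup g), (PresentedGroup.of u : SurfaceGroup g)⁆ ^ (if x.1 = v.1 ∧ x.2 = false ∧ v.2 = true then (1 : ℤ) else if x.1 = v.1 ∧ x.2 = true ∧ v.2 = false then (-1 : ℤ) else 0) * ⁅(PresentedGroup.of u : SurfaceGroup g), (PresentedGroup.of v : SurfaceGroup g)⁆ ^ (if x.1 = w.1 ∧ x.2 = false ∧ w.2 = true then (1 : ℤ) else if x.1 = w.1 ∧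 x.2 = true ∧ w.2 = false then (-1 : ℤ) else 0) * ⁅(PresentedGroup.of v : SurfaceGroup g), (PresentedGroup.of w : SurfaceGroup g)⁆ ^ (if x.1 = u.1 ∧ x.2 = false ∧ u.2 = true then (1 : ℤ) else if x.1 = u.1 ∧ x.2 = true ∧ u.2 = false then (-1 : ℤ) else 0))⁻¹ ∈ (⊤ : Subgroup (SurfaceGroup g)).lowerCentralSeries 2 := by
  rintro ⟨ψ, hψ, hτ⟩
  refine ⟨ψ, hψ, fun x => ?_⟩
  rw [mul_inv_mem_iff_quot, (mul_inv_mem_iff_quot _ _ _).1 (hτ x), quot_triple, quot_triple,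
    c2_rotate3 quot_class_two]

/-- **Realisers are invariant under transposing the triple**: `(u, v, w) → (v, u, w)` (by `ψ⁻¹`).
[folklore] -/
theorem realise_swap (u v w : Fin g × Bool) :
    (∃ ψ : SurfaceGroup g ≃* SurfaceGroup g, (∀ s : SurfaceGroup g, ψ s * s⁻¹ ∈ (⊤ : Subgroup (SurfaceGroup g)).lowerCentralSeries 1) ∧ ∀ x : Fin g × Bool, ψ (PresentedGroup.of x : SurfaceGroup g) * (PresentedGroup.of x : SurfaceGroup g)⁻¹ * (⁅(PresentedGroup.of v : SurfaceGroup g), (PresentedGroup.of w : SurfaceGroup g)⁆ ^ (if x.1 = u.1 ∧ x.2 = false ∧ u.2 = true then (1 : ℤ) else if x.1 = u.1 ∧ x.2 = true ∧ u.2 = false then (-1 : ℤ) else 0) * ⁅(PresentedGroup.of w : SurfaceGroup g), (PresentedGroup.of u : SurfaceGroup g)⁆ ^ (if x.1 = v.1 ∧ x.2 = false ∧ v.2 = true then (1 : ℤ) else if x.1 = v.1 ∧ x.2 = true ∧ v.2 = false then (-1 : ℤ) else 0) * ⁅(PresentedGroup.of u : SurfaceGroup g), (PresentedGroup.of v : SurfaceGroup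 g)⁆ ^ (if x.1 = w.1 ∧ x.2 = false ∧ w.2 = true then (1 : ℤ) else if x.1 = w.1 ∧ x.2 = true ∧ w.2 = false then (-1 : ℤ) else 0))⁻¹ ∈ (⊤ : Subgroup (SurfaceGroup g)).lowerCentralSeries 2) →
    ∃ ψ : SurfaceGroup g ≃* SurfaceGroup g, (∀ s : SurfaceGroup g, ψ s * s⁻¹ ∈ (⊤ : Subgroup (SurfaceGroup g)).lowerCentralSeries 1) ∧ ∀ x : Fin g × Bool, ψ (PresentedGroup.of x : SurfaceGroup g) * (PresentedGroup.of x : SurfaceGroup g)⁻¹ * (⁅(PresentedGroup.of u : SurfaceGroup g), (PresentedGroup.of w : SurfaceGroup g)⁆ ^ (if x.1 = v.1 ∧ x.2 = false ∧ v.2 = true then (1 : ℤ) else if x.1 = v.1 ∧ x.2 = true ∧ v.2 = false then (-1 : ℤ) else 0) * ⁅(PresentedGroup.of w : SurfaceGroup g), (PresentedGroup.of v : SurfaceGroup g)⁆ ^ (if x.1 = u.1 ∧ x.2 = false ∧ u.2 = true then (1 : ℤ) else if x.1 = u.1 ∧ x.2 = true ∧ u.2 = false then (-1 : ℤ) else 0)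 * ⁅(PresentedGroup.of v : SurfaceGroup g), (PresentedGroup.of u : SurfaceGroup g)⁆ ^ (if x.1 = w.1 ∧ x.2 = false ∧ w.2 = true then (1 : ℤ) else if x.1 = w.1 ∧ x.2 = true ∧ w.2 = false then (-1 : ℤ) else 0))⁻¹ ∈ (⊤ : Subgroup (SurfaceGroup g)).lowerCentralSeries 2 := by
  rintro ⟨ψ, hψ, hτ⟩
  refine ⟨ψ.symm, ia_symm hψ, fun x => ?_⟩
  rw [mul_inv_mem_iff_quot, ia_quot_symm hψ, (mul_inv_mem_iff_quot _ _ _).1 (hτ x), quot_triple,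
    quot_triple, ← zpow_neg_one, c2_triple_zpow quot_class_two,
    ← commutatorElement_inv (((PresentedGroup.of w : SurfaceGroup g) : SurfaceGroup g) : SurfaceGroup g ⧸ (⊤ : Subgroup (SurfaceGroup g)).lowerCentralSeries 2) (((PresentedGroup.of u : SurfaceGroup g) : SurfaceGroup g) : SurfaceGroup g ⧸ (⊤ : Subgroup (SurfaceGroup g)).lowerCentralSeries 2), inv_zpow', ← commutatorElement_inv (((PresentedGroup.of v : SurfaceGroup g) : SurfaceGroup g) : SurfaceGroup g ⧸ (⊤ : Subgroup (SurfaceGroup g)).lowerCentralSeries 2) (((PresentedGroup.of w : SurfaceGroup g) : SurfaceGroup g) : SurfaceGroup g ⧸ (⊤ : Subgroup (SurfaceGroup g)).lowerCentralSeries 2), inv_zpow',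
    ← commutatorElement_inv (((PresentedGroup.of u : SurfaceGroup g) : SurfaceGroup g) : SurfaceGroup g ⧸ (⊤ : Subgroup (SurfaceGroup g)).lowerCentralSeries 2) (((PresentedGroup.of v : SurfaceGroup g) : SurfaceGroup g) : SurfaceGroup g ⧸ (⊤ : Subgroup (SurfaceGroup g)).lowerCentralSeries 2), inv_zpow', mul_neg_one, mul_neg_one, mul_neg_one,
    c2_swap12 quot_class_two]

end Transport

/-- **Registered helper**: realisability of `(u, v, w)` (see the module docstring) is invariant under permuting the triple. [folklore] -/
theorem realise_perm : ∀ (g : ℕ) (u v w : Fin g × Bool), (∃ ψ : Literature.Topology.FourManifolds.SurfaceGroup g ≃* Literature.Topology.FourManifolds.SurfaceGroup g, (∀ s : Literature.Topology.FourManifolds.SurfaceGroup g, ψ s * s⁻¹ ∈ (⊤ : Subgroup (Literature.Topology.FourManifolds.SurfaceGroup g)).lowerCentralSeries 1) ∧ ∀ x : Fin g × Bool, ψ (PresentedGroup.of x : Literature.Topology.FourManifolds.SurfaceGroup g) * (PresentedGroup.of x : Literature.Topology.FourManifolds.SurfaceGroup g)⁻¹ * (⁅(PresentedGroup.of v : Literature.Topology.FourManifolds.SurfaceGroup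 g), (PresentedGroup.of w : Literature.Topology.FourManifolds.SurfaceGroup g)⁆ ^ (if x.1 = u.1 ∧ x.2 = false ∧ u.2 = true then (1 : ℤ) else if x.1 = u.1 ∧ x.2 = true ∧ u.2 = false then (-1 : ℤ) else 0) * ⁅(PresentedGroup.of w : Literature.Topology.FourManifolds.SurfaceGroup g), (PresentedGroup.of u : Literature.Topology.FourManifolds.SurfaceGroup g)⁆ ^ (if x.1 = v.1 ∧ x.2 = false ∧ v.2 = true then (1 : ℤ) else if x.1 = v.1 ∧ x.2 = true ∧ v.2 = false then (-1 : ℤ) else 0) * ⁅(PresentedGroup.of u : Literature.Topology.FourManifolds.SurfaceGroup g), (PresentedGroup.of v : Literature.Topology.FourManifolds.SurfaceGroup g)⁆ ^ (if x.1 = w.1 ∧ x.2 = false ∧ w.2 = true then (1 : ℤ) else if x.1 = w.1 ∧ x.2 = true ∧ w.2 = false then (-1 : ℤ) else 0))⁻¹ ∈ (⊤ : Subgroup (Literature.Topology.FourManifolds.SurfaceGroup g)).lowerCentralSeries 2) → (∃ ψ : Literature.Topology.FourManifolds.SurfaceGroup g ≃* Literature.Topology.FourManifolds.SurfaceGroup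 g, (∀ s : Literature.Topology.FourManifolds.SurfaceGroup g, ψ s * s⁻¹ ∈ (⊤ : Subgroup (Literature.Topology.FourManifolds.SurfaceGroup g)).lowerCentralSeries 1) ∧ ∀ x : Fin g × Bool, ψ (PresentedGroup.of x : Literature.Topology.FourManifolds.SurfaceGroup g) * (PresentedGroup.of x : Literature.Topology.FourManifolds.SurfaceGroup g)⁻¹ * (⁅(PresentedGroup.of u : Literature.Topology.FourManifolds.SurfaceGroup g), (PresentedGroup.of w : Literature.Topology.FourManifolds.SurfaceGroup g)⁆ ^ (if x.1 = v.1 ∧ x.2 = false ∧ v.2 = true then (1 : ℤ) else if x.1 = v.1 ∧ x.2 = true ∧ v.2 = false then (-1 : ℤ) else 0) * ⁅(PresentedGroup.of w : Literature.Topology.FourManifolds.SurfaceGroup g), (PresentedGroup.of v : Literature.Topology.FourManifolds.SurfaceGroup g)⁆ ^ (if x.1 = u.1 ∧ x.2 = false ∧ u.2 = true then (1 : ℤ) else if x.1 = u.1 ∧ x.2 = true ∧ u.2 = false then (-1 : ℤ) else 0) * ⁅(PresentedGroup.of v : Literature.Topology.FourManifolds.SurfaceGroup g), (PresentedGroup.of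 u : Literature.Topology.FourManifolds.SurfaceGroup g)⁆ ^ (if x.1 = w.1 ∧ x.2 = false ∧ w.2 = true then (1 : ℤ) else if x.1 = w.1 ∧ x.2 = true ∧ w.2 = false then (-1 : ℤ) else 0))⁻¹ ∈ (⊤ : Subgroup (Literature.Topology.FourManifolds.SurfaceGroup g)).lowerCentralSeries 2) ∧ (∃ ψ : Literature.Topology.FourManifolds.SurfaceGroup g ≃* Literature.Topology.FourManifolds.SurfaceGroup g, (∀ s : Literature.Topology.FourManifolds.SurfaceGroup g, ψ s * s⁻¹ ∈ (⊤ : Subgroup (Literature.Topology.FourManifolds.SurfaceGroup g)).lowerCentralSeries 1) ∧ ∀ x : Fin g × Bool, ψ (PresentedGroup.of x : Literature.Topology.FourManifolds.SurfaceGroup g) * (PresentedGroup.of x : Literature.Topology.FourManifolds.SurfaceGroup g)⁻¹ * (⁅(PresentedGroup.of w : Literature.Topology.FourManifolds.SurfaceGroup g), (PresentedGroup.of u : Literature.Topology.FourManifolds.SurfaceGroup g)⁆ ^ (if x.1 = v.1 ∧ x.2 = false ∧ v.2 = true then (1 : ℤ) else if x.1 = v.1 ∧ x.2 = true ∧ v.2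 = false then (-1 : ℤ) else 0) * ⁅(PresentedGroup.of u : Literature.Topology.FourManifolds.SurfaceGroup g), (PresentedGroup.of v : Literature.Topology.FourManifolds.SurfaceGroup g)⁆ ^ (if x.1 = w.1 ∧ x.2 = false ∧ w.2 = true then (1 : ℤ) else if x.1 = w.1 ∧ x.2 = true ∧ w.2 = false then (-1 : ℤ) else 0) * ⁅(PresentedGroup.of v : Literature.Topology.FourManifolds.SurfaceGroup g), (PresentedGroup.of w : Literature.Topology.FourManifolds.SurfaceGroup g)⁆ ^ (if x.1 = u.1 ∧ x.2 = false ∧ u.2 = true then (1 : ℤ) else if x.1 = u.1 ∧ x.2 = true ∧ u.2 = false then (-1 : ℤ) else 0))⁻¹ ∈ (⊤ : Subgroup (Literature.Topology.FourManifolds.SurfaceGroup g)).lowerCentralSeries 2) := by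
  intro g u v w h
  exact ⟨realise_swap u v w h, realise_rotate u v w h⟩


/-- **Registered helper `helper_johnsonRealisePerm`** (sub-goal of the lead's skeleton): the inverse of a
signed-letter-permuting automorphism permutes signed letters up to conjugacy (closed form of
`equiv_symm_of`; the transport theorems `realise_transport` / `realise_swap` / `realise_rotate` /
`realise_perm` above ride with it). [folklore] -/
theorem helper_johnsonRealisePerm : ∀ (g : ℕ) (π : Fin g × Bool → Fin g × Bool) (e : Fin g × Bool → ℤ), (∀ x, e x = 1 ∨ e x = -1) → ∀ (φ : Literature.Topology.FourManifolds.SurfaceGroup g ≃* Literature.Topology.FourManifolds.SurfaceGroup g), (∀ x, ∃ h : Literature.Topology.FourManifolds.SurfaceGroup g, φ (PresentedGroup.of x : Literature.Topology.FourManifolds.SurfaceGroup g) = h * (PresentedGroup.of (π x) : Literature.Topology.FourManifolds.SurfaceGroup g) ^ (e x) * h⁻¹) → ∀ x' : Fin g × Bool, ∃ k : Literature.Topology.FourManifolds.SurfaceGroup g, φ.symm (PresentedGroup.of (π x') : Literature.Topology.FourManifolds.SurfaceGroup g) = k * (PresentedGroup.of x' : Literature.Topology.FourManifolds.SurfaceGroup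 g) ^ (e x') * k⁻¹ :=
  fun _ π e he φ hφ x' => equiv_symm_of π e he φ hφ x'

end Summit.SmoothPoincare4.SmoothPoincare4.Theorems.NilpotentShadowsStandard.SaturatedTorsorDescent
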